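import Mathlib
import Literature.Analysis.FluidPDE.VectorCalculus

/-!
# `SkeletonEquilibrium` (stmt-NavierStokesRegularity-15400), line `Sketch`: the outer slope-½ law

Tools stub `stub_outerSlopeHalf` of the lead skeleton. Far from the waist each filament of the
relative equilibrium solves, in the outer variable, the unit-speed "Lorentz-force" profile equation
`Y″ = Y′ × AY` with the rotating Leray drift `A y = ½ y − α e₃ × y` (`e₃ = EuclideanSpace.single 2 1`).
Its key exact integral: the drift slip `g(s) = ⟪Y′(s), AY(s)⟫` has `g′ ≡ ½`
(`⟪Y″, AY⟫ = ⟪Y′ × AY, AY⟫ = 0` and `⟪Y′, AY′⟫ = ½‖Y′‖² − α⟪Y′, e₃ × Y′⟫ = ½`), and consequently,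
integrating from a zero `s₀` of `g` and using Cauchy–Schwarz with
`4‖AY‖² = (1 + 4α²)(Y₀² + Y₁²) + Y₂² ≤ (1 + 4α²)‖Y‖²`, the linear properness bound
`|s − s₀| ≤ √(1 + 4α²) ‖Y(s)‖`.
-/

noncomputable section

namespace Summit.NavierStokesRegularity.NavierStokesRegularity.Theorems.SkeletonEquilibrium.Sketch
set_option linter.dupNamespace false

open Literature.Analysis.FluidPDE
open scoped RealInnerProductSpace InnerProductSpace

/-- `⟪a × b, b⟫ = 0`: a cross product is orthogonal to its second factor (coordinate expansion of
Mathlib's `crossProduct` transported to `EuclideanSpace ℝ (Fin 3)`). [folklore] -/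
private theorem inner_cross_self_right (a b : EuclideanSpace ℝ (Fin 3)) : ⟪cross a b, b⟫ = 0 := by
  simp only [cross, PiLp.inner_apply, RCLike.inner_apply, conj_trivial, Fin.sum_univ_three,
    cross_apply, Matrix.cons_val_zero, Matrix.cons_val_one, Matrix.cons_val_two,
    Matrix.head_cons, Matrix.tail_cons]
  ring

/-- `⟪b, a × b⟫ = 0`: a cross product is orthogonal to its second factor (symmetric form of
`inner_cross_self_right`). [folklore] -/
private theorem inner_self_cross_right (a b : EuclideanSpace ℝ (Fin 3)) : ⟪b, cross a b⟫ = 0 := by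
  rw [real_inner_comm]
  exact inner_cross_self_right a b

/-- The drift comparison `4 ‖½ y − α e₃ × y‖² ≤ (1 + 4α²) ‖y‖²`: in coordinates
`e₃ × y = (−y₁, y₀, 0)`, so `4‖½ y − α e₃ × y‖² = (1 + 4α²)(y₀² + y₁²) + y₂²`. [folklore] -/
private theorem four_mul_norm_drift_sq_le (α : ℝ) (y : EuclideanSpace ℝ (Fin 3)) :
    4 * ‖(1 / 2 : ℝ) • y - α • cross (EuclideanSpace.single (2 : Fin 3) (1 : ℝ)) y‖ ^ 2 ≤
      (1 + 4 * α ^ 2) * ‖y‖ ^ 2 := by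
  rw [EuclideanSpace.real_norm_sq_eq, EuclideanSpace.real_norm_sq_eq]
  simp only [Fin.sum_univ_three, cross, PiLp.sub_apply, PiLp.smul_apply, smul_eq_mul,
    cross_apply, PiLp.ofLp_single, Pi.single_apply,
    Matrix.cons_val_zero, Matrix.cons_val_one, Matrix.cons_val_two, Matrix.head_cons,
    Matrix.tail_cons]
  simp
  nlinarith [sq_nonneg (α * y 2), sq_nonneg (y 0), sq_nonneg (y 1)]

/-- The drift `½ Y − α e₃ × Y` along a differentiable curve has derivative `½ Y′ − α e₃ × Y′`
(linearity of `y ↦ ½ y − α e₃ × y`, bundled through `crossCLM`). [folklore] -/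
private theorem hasDerivAt_drift {α : ℝ} {Y : ℝ → EuclideanSpace ℝ (Fin 3)}
    {T : EuclideanSpace ℝ (Fin 3)} {s : ℝ} (hY : HasDerivAt Y T s) :
    HasDerivAt
      (fun σ => (1 / 2 : ℝ) • Y σ - α • cross (EuclideanSpace.single (2 : Fin 3) (1 : ℝ)) (Y σ))
      ((1 / 2 : ℝ) • T - α • cross (EuclideanSpace.single (2 : Fin 3) (1 : ℝ)) T) s := by
  set L : EuclideanSpace ℝ (Fin 3) →L[ℝ] EuclideanSpace ℝ (Fin 3) :=
    (1 / 2 : ℝ) • ContinuousLinearMap.id ℝ _ -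
      α • crossCLM (EuclideanSpace.single (2 : Fin 3) (1 : ℝ)) with hL
  have hLapp : ∀ y, L y =
      (1 / 2 : ℝ) • y - α • cross (EuclideanSpace.single (2 : Fin 3) (1 : ℝ)) y :=
    fun y => by simp [hL, crossCLM_apply]
  have h := L.hasFDerivAt.comp_hasDerivAt s hY
  have hfun : (fun σ => (1 / 2 : ℝ) • Y σ -
      α • cross (EuclideanSpace.single (2 : Fin 3) (1 : ℝ)) (Y σ)) = L ∘ Y := by
    funext σ; simp [hLapp]
  rw [hfun, ← hLapp]
  exact h

/-- **Slope ½.** For a `C²` unit-speed solution of `Y″ = Y′ × (½ Y − α e₃ × Y)` the drift slip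
`s ↦ ⟪Y′ s, ½ Y s − α e₃ × Y s⟫` has derivative exactly `½` at every point: by the product rule
its derivative is `⟪Y′, ½ Y′ − α e₃ × Y′⟫ + ⟪Y″, ½ Y − α e₃ × Y⟫`; the second term vanishes because
`Y″ = Y′ × (drift)` is orthogonal to the drift, the first is `½ ‖Y′‖² − α ⟪Y′, e₃ × Y′⟫ = ½`.
[folklore] -/
private theorem hasDerivAt_slip {α : ℝ} {Y : ℝ → EuclideanSpace ℝ (Fin 3)} (hY : ContDiff ℝ 2 Y)
    (hunit : ∀ s, ‖deriv Y s‖ = 1)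
    (hode : ∀ s, iteratedDeriv 2 Y s = cross (deriv Y s)
      ((1 / 2 : ℝ) • Y s - α • cross (EuclideanSpace.single (2 : Fin 3) (1 : ℝ)) (Y s)))
    (s : ℝ) :
    HasDerivAt (fun σ => ⟪deriv Y σ,
      (1 / 2 : ℝ) • Y σ - α • cross (EuclideanSpace.single (2 : Fin 3) (1 : ℝ)) (Y σ)⟫)
      (1 / 2) s := by
  have hYd : Differentiable ℝ Y := hY.differentiable (by norm_num)
  have hTd : Differentiable ℝ (deriv Y) := hY.differentiable_deriv_two
  have h2 : iteratedDeriv 2 Y = deriv (deriv Y) := by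
    rw [iteratedDeriv_succ, iteratedDeriv_one]
  have hY'' : deriv (deriv Y) s = cross (deriv Y s)
      ((1 / 2 : ℝ) • Y s - α • cross (EuclideanSpace.single (2 : Fin 3) (1 : ℝ)) (Y s)) := by
    rw [← h2, hode s]
  have h := (hTd s).hasDerivAt.inner ℝ (hasDerivAt_drift (α := α) (hYd s).hasDerivAt)
  refine h.congr_deriv ?_
  rw [hY'', inner_cross_self_right, add_zero, inner_sub_right, real_inner_smul_right,
    real_inner_smul_right, real_inner_self_eq_norm_sq, hunit s, inner_self_cross_right]
  ring

/-- **Linear slip.** Under the hypotheses of `hasDerivAt_slip`, if the drift slip vanishes at `s₀`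
then it equals `(s − s₀)/2` everywhere (a function with constant derivative `½`). [folklore] -/
private theorem slip_eq {α : ℝ} {Y : ℝ → EuclideanSpace ℝ (Fin 3)} (hY : ContDiff ℝ 2 Y)
    (hunit : ∀ s, ‖deriv Y s‖ = 1)
    (hode : ∀ s, iteratedDeriv 2 Y s = cross (deriv Y s)
      ((1 / 2 : ℝ) • Y s - α • cross (EuclideanSpace.single (2 : Fin 3) (1 : ℝ)) (Y s)))
    {s₀ : ℝ} (hs₀ : ⟪deriv Y s₀,
      (1 / 2 : ℝ) • Y s₀ - α • cross (EuclideanSpace.single (2 : Fin 3) (1 : ℝ)) (Y s₀)⟫ = 0)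
    (s : ℝ) :
    ⟪deriv Y s, (1 / 2 : ℝ) • Y s - α • cross (EuclideanSpace.single (2 : Fin 3) (1 : ℝ)) (Y s)⟫
      = (s - s₀) / 2 := by
  have hslip := hasDerivAt_slip hY hunit hode
  have hφ : ∀ σ, HasDerivAt (fun σ => ⟪deriv Y σ,
      (1 / 2 : ℝ) • Y σ - α • cross (EuclideanSpace.single (2 : Fin 3) (1 : ℝ)) (Y σ)⟫ -
        (1 / 2 : ℝ) * σ) (1 / 2 - 1 / 2 * 1) σ :=
    fun σ => (hslip σ).sub ((hasDerivAt_id σ).const_mul (1 / 2 : ℝ))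
  have hconst : ⟪deriv Y s,
      (1 / 2 : ℝ) • Y s - α • cross (EuclideanSpace.single (2 : Fin 3) (1 : ℝ)) (Y s)⟫ -
        (1 / 2 : ℝ) * s = ⟪deriv Y s₀,
      (1 / 2 : ℝ) • Y s₀ - α • cross (EuclideanSpace.single (2 : Fin 3) (1 : ℝ)) (Y s₀)⟫ -
        (1 / 2 : ℝ) * s₀ :=
    is_const_of_deriv_eq_zero (fun σ => (hφ σ).differentiableAt)
      (fun σ => by rw [(hφ σ).deriv]; ring) s s₀
  rw [hs₀] at hconst
  linarith

/-- Tools stub T2: the outer slope-½ law. For a `C²` unit-speed solution of the rotating self-similar binormal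
profile equation `Y″ = Y′ × AY`, `A y = ½ y − α e₃ × y`, the drift slip `⟨Y′, AY⟩` has derivative EXACTLY `½`,
hence (integrating from a zero `s₀`) the linear properness bound `|s − s₀| ≤ √(1 + 4α²) ‖Y(s)‖`. [folklore] -/
theorem stub_outerSlopeHalf : ∀ (α : ℝ) (Y : ℝ → EuclideanSpace ℝ (Fin 3)), ContDiff ℝ 2 Y → (∀ s, ‖deriv Y s‖ = 1) → (∀ s, iteratedDeriv 2 Y s = Literature.Analysis.FluidPDE.cross (deriv Y s) ((1 / 2 : ℝ) • Y s - α • Literature.Analysis.FluidPDE.cross (EuclideanSpace.single (2 : Fin 3) (1 : ℝ)) (Y s))) → (∀ s, deriv (fun σ => inner ℝ (deriv Y σ) ((1 / 2 : ℝ) • Y σ - α • Literature.Analysis.FluidPDE.cross (EuclideanSpace.single (2 : Fin 3) (1 : ℝ)) (Y σ))) s = 1 / 2) ∧ (∀ s₀, inner ℝ (deriv Y s₀) ((1 / 2 : ℝ) • Y s₀ - α • Literature.Analysis.FluidPDE.cross (EuclideanSpace.single (2 : Fin 3) (1 : ℝ)) (Y s₀)) = 0 → ∀ s, |s - s₀|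 ≤ Real.sqrt (1 + 4 * α ^ 2) * ‖Y s‖) := by
  intro α Y hY hunit hode
  refine ⟨fun s => (hasDerivAt_slip hY hunit hode s).deriv, fun s₀ hs₀ s => ?_⟩
  have hgs := slip_eq hY hunit hode hs₀ s
  -- Cauchy–Schwarz: `|g s| ≤ ‖Y′ s‖ ‖drift‖ = ‖drift‖`
  have hcs : |(s - s₀) / 2| ≤
      ‖(1 / 2 : ℝ) • Y s - α • cross (EuclideanSpace.single (2 : Fin 3) (1 : ℝ)) (Y s)‖ := by
    have h := abs_real_inner_le_norm (deriv Y s)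
      ((1 / 2 : ℝ) • Y s - α • cross (EuclideanSpace.single (2 : Fin 3) (1 : ℝ)) (Y s))
    rwa [hunit s, one_mul, hgs] at h
  have hV := four_mul_norm_drift_sq_le α (Y s)
  have hR : 0 ≤ Real.sqrt (1 + 4 * α ^ 2) * ‖Y s‖ := by positivity
  refine (sq_le_sq₀ (abs_nonneg _) hR).1 ?_
  rw [mul_pow, Real.sq_sqrt (by positivity), sq_abs]
  have h1 : |(s - s₀) / 2| ^ 2 ≤
      ‖(1 / 2 : ℝ) • Y s - α • cross (EuclideanSpace.single (2 : Fin 3) (1 : ℝ)) (Y s)‖ ^ 2 :=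
    pow_le_pow_left₀ (abs_nonneg _) hcs 2
  rw [sq_abs] at h1
  nlinarith [h1, hV]

end Summit.NavierStokesRegularity.NavierStokesRegularity.Theorems.SkeletonEquilibrium.Sketch
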